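import Literature.Topology.FourManifolds.HCobordismSlideStepCrossingValue
import HarnessLib

/-!
# Milnor 1965, proof of Thm. 7.6 (PDF p. 52): the derivative of the normal coordinate of
# `D_R(p₂)` along the slid disc `D_L'(p₁)` at the crossing — its determinant has a sign that
# does not depend on the docking nor on the outcome of the geometric half

Topic `Literature/Topology/FourManifolds`; a brick for the last hypothesis `HSgn` (*"with
intersection number `D_R(p₂) · D_L'(p₁) = +1`"* — the sign comparison of the two dockings) of
`Cobordism.Milnor1965_basisTheorem_slab_of_crossingSign` (`HCobordismSlideStepCrossingValue.lean`),
i.e. of the named fact `Literature.Topology.FourManifolds.Cobordism.Milnor1965_basisTheorem_slab`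
(Milnor, *Lectures on the h-cobordism theorem* (1965), Thm. 7.6 on a slab).  The value of the
functional of a transverse disc datum `Tⱼ` of `D_R(σ j)` on the class of the slid disc is
`(a · sign det L) • w₀` (`TransverseDiscDatum.functional_map_eq_smul_of_single`), `L` the
derivative at the crossing parameter `p⋆` of the normal coordinate `K̃ⱼ ∘ E` read in the
Euclidean crossing chart `E` of the slid disc (`SlideSetting.exists_crossingChart`).
`Cobordism.slideStep_crossingValue` (the hypothesis `HV`) proved `det L ≠ 0`; to compare the two
dockings one needs that **the sign of `det L` is the same for every docking `ρ` and every
outcome**, for a FIXED flow-regular datum `Tⱼ` chosen beforehand.  This file proves it: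

* **`Cobordism.slideStep_crossingDerivative`** — for a slide setting `S`, a presentation `X`
  of the slab and a flow-regular datum `Tⱼ` of `D_R(σ j)` with its extended normal coordinate
  `K̃ⱼ` (the interface of `Cobordism.exists_flowRegular_transverseDiscDatum`, its box below the
  level `c₀`), there is a sign `s₀ = ±1` such that for EVERY docking `ρ` and EVERY outcome of
  `SlideSetting.exists_slidePair ρ`: the crossing chart `(V, p⋆, E)` of
  `SlideSetting.exists_crossingChart` (reaching the level `t₂'`, all its conclusions repeated)
  together with a function `f = K̃ⱼ ∘ E` near `p⋆` and its derivative `L` at `p⋆`, `det L ≠ 0`,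
  **`sign det L = s₀`**.

Proof (Milnor, PDF p. 52; Thm. 3.4 for the product structure of the band).  As in the proof of
`HV`: near `p⋆ = L_k(a⋆, 0)`, `K̃ⱼ (E (L_k(a, x))) = G (1 + (3/2) λ(2ν(a) - 1), X(x), 0)` with
`G := K̃ⱼ ∘ ι ∘ ψ_R` (flow invariance of `K̃ⱼ`, the formula of the isotopy near the docking
centre, and `Φ⁻¹ = ψ_R` near `z⋆ = (2, 0, 0)` — so that `G` does **not** depend on the
outcome), `X` the sheet coordinate (`SlideSetting.exists_hasFDerivAt_sheetCoord`, from `S`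
alone) and only the scalar `d = (d/da)[1 + (3/2) λ(2ν(a) - 1)](a⋆) < 0`
(`hasDerivAt_sweepProfile`) depending on the outcome.  Hence `L = G' ∘ (d ⊕ X') ∘ L_k⁻¹` and,
`G'` restricted to the `(s, x)`-plane being an isomorphism `G''` (right inverse from the
right-inverse germ of `K̃ⱼ` at a point of `D_R(σ j)` in the band, kernel the `y`-directions),
`det L = det (G'' (d ⊕ 1) G''⁻¹) · det A = d · det A` with `A := G' ∘ (1 ⊕ X') ∘ L_k⁻¹` fixed:
`sign det L = - sign det A =: s₀`.

Everything here is proved; no definitions, no named facts.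

## References

* J. Milnor, *Lectures on the h-cobordism theorem*, notes by L. Siebenmann and J. Sondow,
  Princeton Mathematical Notes (1965): Def. 3.9 (PDF p. 16), Thm. 3.4 (PDF pp. 12–13), Lemma 7.7
  and the proof of Thm. 7.6 (PDF pp. 50–52).  Held:
  `lit read book:milnornd-lectures-h-cobordism-theorem`. [MilnorHCobordism1965]
* A. Hatcher, *Algebraic Topology*, CUP 2002, §3.3 pp. 233–236 (local degree `sign det`).
  [HatcherAT2002]
-/

open scoped Manifold ContDiff Topology
open Set Function Filter Metric CategoryTheory OpenPartialHomeomorph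
open Literature.AlgebraicTopology.SingularHomology

noncomputable section

namespace Literature.Topology.FourManifolds

universe u

/-! ### Linear algebra: scaling one coordinate before an isomorphism of the `(s, x)`-plane -/

/-- **Scaling the `s`-coordinate scales the determinant.**  In the setting of
`crossing_det_ne_zero` (`G'` linear on `ℝ × ℝ^{k-1} × ℝᵐ` with a right inverse and killing
`0 × 0 × ℝᵐ`, so that its restriction `G''` to the `(s, x)`-plane is an isomorphism onto `ℝᵏ`),
the composite `L_d = G' ∘ (d a, X' x, 0)` (`(a, x) = Λ p`) satisfies `det L_d = d · det L₁`:
`L_d = (G'' ∘ (d ⊕ 1) ∘ G''⁻¹) ∘ L₁`. [folklore] -/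
theorem crossing_det_smul {k m : ℕ} (hk : 1 ≤ k)
    (G' : (ℝ × EuclideanSpace ℝ (Fin (k - 1)) × EuclideanSpace ℝ (Fin m)) →L[ℝ] EuclideanSpace ℝ (Fin k))
    (m' : EuclideanSpace ℝ (Fin k) →L[ℝ] (ℝ × EuclideanSpace ℝ (Fin (k - 1)) × EuclideanSpace ℝ (Fin m)))
    (hGm : ∀ w, G' (m' w) = w)
    (hY : ∀ y, G' ((0 : ℝ), (0 : EuclideanSpace ℝ (Fin (k - 1))), y) = 0)
    (d : ℝ) (X' : EuclideanSpace ℝ (Fin (k - 1)) →L[ℝ] EuclideanSpace ℝ (Fin (k - 1)))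
    (Λ : EuclideanSpace ℝ (Fin k) ≃L[ℝ] (ℝ × EuclideanSpace ℝ (Fin (k - 1)))) :
    LinearMap.det ((G'.comp ((d • ((ContinuousLinearMap.fst ℝ ℝ (EuclideanSpace ℝ (Fin (k - 1)))).comp
        (Λ : EuclideanSpace ℝ (Fin k) →L[ℝ] ℝ × EuclideanSpace ℝ (Fin (k - 1))))).prod
      ((X'.comp ((ContinuousLinearMap.snd ℝ ℝ (EuclideanSpace ℝ (Fin (k - 1)))).comp
        (Λ : EuclideanSpace ℝ (Fin k) →L[ℝ] ℝ × EuclideanSpace ℝ (Fin (k - 1))))).prod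
        (0 : EuclideanSpace ℝ (Fin k) →L[ℝ] EuclideanSpace ℝ (Fin m))))) :
        EuclideanSpace ℝ (Fin k) →ₗ[ℝ] EuclideanSpace ℝ (Fin k)) =
    d * LinearMap.det ((G'.comp (((1 : ℝ) • ((ContinuousLinearMap.fst ℝ ℝ (EuclideanSpace ℝ (Fin (k - 1)))).comp
        (Λ : EuclideanSpace ℝ (Fin k) →L[ℝ] ℝ × EuclideanSpace ℝ (Fin (k - 1))))).prod
      ((X'.comp ((ContinuousLinearMap.snd ℝ ℝ (EuclideanSpace ℝ (Fin (k - 1)))).comp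
        (Λ : EuclideanSpace ℝ (Fin k) →L[ℝ] ℝ × EuclideanSpace ℝ (Fin (k - 1))))).prod
        (0 : EuclideanSpace ℝ (Fin k) →L[ℝ] EuclideanSpace ℝ (Fin m))))) :
        EuclideanSpace ℝ (Fin k) →ₗ[ℝ] EuclideanSpace ℝ (Fin k)) := by
  -- the restriction of `G'` to the `(s, x)`-plane is a linear isomorphism onto `ℝᵏ`
  set G'' : (ℝ × EuclideanSpace ℝ (Fin (k - 1))) →ₗ[ℝ] EuclideanSpace ℝ (Fin k) :=
    (G' : _ →ₗ[ℝ] _).comp ((LinearMap.fst ℝ ℝ (EuclideanSpace ℝ (Fin (k - 1)))).prod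
      ((LinearMap.snd ℝ ℝ (EuclideanSpace ℝ (Fin (k - 1)))).prod
        (0 : (ℝ × EuclideanSpace ℝ (Fin (k - 1))) →ₗ[ℝ] EuclideanSpace ℝ (Fin m)))) with hG''
  have hG''apply : ∀ v : ℝ × EuclideanSpace ℝ (Fin (k - 1)),
      G'' v = G' (v.1, v.2, (0 : EuclideanSpace ℝ (Fin m))) := fun v => rfl
  have hsurj : Surjective G'' := by
    intro w
    refine ⟨((m' w).1, (m' w).2.1), ?_⟩
    have hsplit : (m' w) = (((m' w).1, (m' w).2.1, (0 : EuclideanSpace ℝ (Fin m))) : ℝ × _ × _) +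
        ((0 : ℝ), (0 : EuclideanSpace ℝ (Fin (k - 1))), (m' w).2.2) := by
      ext <;> simp
    calc G'' ((m' w).1, (m' w).2.1)
        = G' ((m' w).1, (m' w).2.1, (0 : EuclideanSpace ℝ (Fin m))) := rfl
      _ = G' ((m' w).1, (m' w).2.1, (0 : EuclideanSpace ℝ (Fin m))) +
            G' ((0 : ℝ), (0 : EuclideanSpace ℝ (Fin (k - 1))), (m' w).2.2) := by rw [hY, add_zero]
      _ = G' ((((m' w).1, (m' w).2.1, (0 : EuclideanSpace ℝ (Fin m))) : ℝ × _ × _) +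
            ((0 : ℝ), (0 : EuclideanSpace ℝ (Fin (k - 1))), (m' w).2.2)) := by rw [map_add]
      _ = G' (m' w) := by rw [← hsplit]
      _ = w := hGm w
  have hdim : Module.finrank ℝ (ℝ × EuclideanSpace ℝ (Fin (k - 1))) =
      Module.finrank ℝ (EuclideanSpace ℝ (Fin k)) := by
    simp only [Module.finrank_prod, Module.finrank_self, finrank_euclideanSpace_fin]
    omega
  have hinj : Injective G'' := (LinearMap.injective_iff_surjective_of_finrank_eq_finrank hdim).2 hsurj
  set Geq : (ℝ × EuclideanSpace ℝ (Fin (k - 1))) ≃ₗ[ℝ] EuclideanSpace ℝ (Fin k) :=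
    LinearEquiv.ofBijective G'' ⟨hinj, hsurj⟩ with hGeq
  have hGeq_apply : ∀ v, Geq v = G'' v := fun v => rfl
  -- the maps `L_e`, `e` a scalar, and the factorisation `L_e = (Geq ∘ D_e ∘ Geq⁻¹) ∘ L_1`
  set P : EuclideanSpace ℝ (Fin k) →ₗ[ℝ] (ℝ × EuclideanSpace ℝ (Fin (k - 1))) :=
    ((LinearMap.fst ℝ ℝ (EuclideanSpace ℝ (Fin (k - 1)))).comp (Λ : EuclideanSpace ℝ (Fin k) →ₗ[ℝ] _)).prod
      ((X' : _ →ₗ[ℝ] _).comp ((LinearMap.snd ℝ ℝ (EuclideanSpace ℝ (Fin (k - 1)))).comp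
        (Λ : EuclideanSpace ℝ (Fin k) →ₗ[ℝ] _))) with hP
  set D : ℝ → ((ℝ × EuclideanSpace ℝ (Fin (k - 1))) →ₗ[ℝ] (ℝ × EuclideanSpace ℝ (Fin (k - 1)))) :=
    fun e => LinearMap.prodMap (e • LinearMap.id) LinearMap.id with hD
  have hLe : ∀ e : ℝ, ((G'.comp ((e • ((ContinuousLinearMap.fst ℝ ℝ (EuclideanSpace ℝ (Fin (k - 1)))).comp
        (Λ : EuclideanSpace ℝ (Fin k) →L[ℝ] ℝ × EuclideanSpace ℝ (Fin (k - 1))))).prod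
      ((X'.comp ((ContinuousLinearMap.snd ℝ ℝ (EuclideanSpace ℝ (Fin (k - 1)))).comp
        (Λ : EuclideanSpace ℝ (Fin k) →L[ℝ] ℝ × EuclideanSpace ℝ (Fin (k - 1))))).prod
        (0 : EuclideanSpace ℝ (Fin k) →L[ℝ] EuclideanSpace ℝ (Fin m))))) :
        EuclideanSpace ℝ (Fin k) →ₗ[ℝ] EuclideanSpace ℝ (Fin k)) = G''.comp ((D e).comp P) := by
    intro e
    apply LinearMap.ext
    intro v
    rfl
  have hfac : ∀ e : ℝ, G''.comp ((D e).comp P) =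
      ((Geq : _ →ₗ[ℝ] _).comp ((D e).comp (Geq.symm : _ →ₗ[ℝ] _))).comp (G''.comp ((D 1).comp P)) := by
    intro e
    apply LinearMap.ext
    intro v
    simp only [LinearMap.comp_apply]
    have h1 : D 1 (P v) = P v := by
      simp only [hD, LinearMap.prodMap_apply, one_smul, LinearMap.id_apply]
    rw [h1, show G'' (P v) = Geq (P v) from rfl, LinearEquiv.coe_coe, LinearEquiv.coe_coe,
      LinearEquiv.symm_apply_apply]
    rfl
  have hdetD : ∀ e : ℝ, LinearMap.det (D e) = e := by
    intro e
    rw [hD]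
    simp only
    rw [LinearMap.det_prodMap, LinearMap.det_smul, LinearMap.det_id, LinearMap.det_id]
    simp
  rw [hLe d, hLe 1, hfac d, LinearMap.det_comp]
  congr 1
  rw [LinearMap.det_conj (D d) Geq, hdetD]

/-! ### The crossing derivative -/

set_option maxHeartbeats 1600000 in
/-- **The sign of the crossing derivative is the same for every docking and every outcome**
(Milnor 1965, proof of Thm. 7.6, PDF p. 52: *"`D_L'(p₁)` intersects `D_R(p₂)` in a single
point, transversely"*, with the sign analysis of the module docstring).  For a slide setting
`S` with `t₁ < 1`, a presentation `X` of the slab, and a flow-regular transverse disc datum `Tⱼ`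
of `D_R(σ j)` on `X` with extended normal coordinate `K̃ⱼ` on an open region `R`
(`K̃ⱼ = Tⱼ.K` on `R`, `K̃ⱼ` constant along `ξ`-trajectory segments in `R`, right-inverse germs
of `K̃ⱼ` at the points of `D_R(σ j) ∩ R`, and `R ⊇ D_R(σ j) ∩ g₁⁻¹[c₀, c₁)` — the interface of
`Cobordism.exists_flowRegular_transverseDiscDatum` with its box below the level `c₀`): there is
`s₀ = ±1` such that for every docking `ρ` and every outcome of
`SlideSetting.exists_slidePair ρ` there are the crossing chart `(V, p⋆, E)` of the slid disc
`D_L'(σ i)` (all conclusions of `SlideSetting.exists_crossingChart`, reaching the level `t₂'`)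
and a map `f` with `f = K̃ⱼ ∘ E = Tⱼ.K ∘ E` near `p⋆`, differentiable at `p⋆` with derivative
`L`, `det L ≠ 0` and `sign det L = s₀`.
[cite: MilnorHCobordism1965, proof of Thm. 7.6 (PDF p. 52), Thm. 3.4 (PDF pp. 12–13), Def. 3.9 (PDF p. 16); HatcherAT2002, §3.3 pp. 233–236] -/
theorem Cobordism.slideStep_crossingDerivative
    {n : ℕ} {M N : Type u} [TopologicalSpace M] [T2Space M] [SecondCountableTopology M]
    [ChartedSpace (EuclideanSpace ℝ (Fin n)) M] [IsManifold (𝓡 n) ∞ M] [CompactSpace M]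
    [TopologicalSpace N] [T2Space N] [SecondCountableTopology N]
    [ChartedSpace (EuclideanSpace ℝ (Fin n)) N] [IsManifold (𝓡 n) ∞ N] [CompactSpace N]
    {c : Cobordism n M N} {g : c.W → ℝ}
    {ξ : Cₛ^∞⟮𝓡∂ (n + 1); EuclideanSpace ℝ (Fin (n + 1)), (TangentSpace (𝓡∂ (n + 1)) : c.W → Type)⟯}
    {t₀ t₁ b : ℝ} {k a : ℕ} {σ : Fin a → c.W} {i j : Fin a}
    (S : SlideSetting c g ξ t₀ t₁ b k σ i j)
    {X : Set c.W} (hX : ∀ z, z ∈ X ↔ g z ∈ Icc t₀ t₁)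
    (Tj : TransverseDiscDatum ↥X k)
    (hPj : ∀ z : ↥X, z ∈ Tj.P ↔ (z : c.W) ∈ unstableSet (𝓡∂ (n + 1)) (⇑ξ) (σ j))
    (R : Set c.W) (Kt : c.W → EuclideanSpace ℝ (Fin k)) (hRo : IsOpen R)
    (hKts : ContMDiffOn (𝓡∂ (n + 1)) 𝓘(ℝ, EuclideanSpace ℝ (Fin k)) ∞ Kt R)
    (hKtK : ∀ z : ↥X, (z : c.W) ∈ R → ∃ hzN : z ∈ Tj.N, Tj.K ⟨z, hzN⟩ = Kt z)
    (hKtinv : ∀ z z', z ∈ R → z' ∈ R → FlowsTo (𝓡∂ (n + 1)) (⇑ξ) z z' → Kt z = Kt z')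
    (hKtrank : ∀ y ∈ unstableSet (𝓡∂ (n + 1)) (⇑ξ) (σ j), y ∈ R →
      ∃ m : EuclideanSpace ℝ (Fin k) → c.W, m 0 = y ∧ ∀ᶠ w in 𝓝 (0 : EuclideanSpace ℝ (Fin k)),
        ContMDiffAt 𝓘(ℝ, EuclideanSpace ℝ (Fin k)) (𝓡∂ (n + 1)) ∞ m w ∧ m w ∈ R ∧ Kt (m w) = w)
    (hRmem : ∀ y ∈ unstableSet (𝓡∂ (n + 1)) (⇑ξ) (σ j), S.c₀ ≤ S.g₁ y → S.g₁ y < S.c₁ → y ∈ R) :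
    ∃ s₀ : ℤ, (s₀ = 1 ∨ s₀ = -1) ∧
    ∀ (ρ : (EuclideanSpace ℝ (Fin (k - 1))) ≃ₗᵢ[ℝ] EuclideanSpace ℝ (Fin (k - 1)))
      (f : S.V ≃ₘ⟮𝓡 n, 𝓡 n⟯ S.V) (_ : Diffeomorph.IsCompactlyDiffeotopicToIdIn S.W f)
      (_ : ∀ v ∈ S.Flat, ‖v‖ ≤ 1 → f (S.discA ρ v) = S.discB v)
      (Φ : OpenPartialHomeomorph S.V (SlideSetting.Model n k))
      (_ : ContMDiffOn (𝓡 n) 𝓘(ℝ, SlideSetting.Model n k) ∞ Φ Φ.source)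
      (_ : ContMDiffOn 𝓘(ℝ, SlideSetting.Model n k) (𝓡 n) ∞ Φ.symm Φ.target)
      (_ : ∀ z, Φ.symm z ∈ S.rightSphere S.jR ↔ z.1 = 2 ∧ z.2.1 = 0)
      (_ : ∀ l, l ≠ S.jR → ∀ z, Φ.symm z ∉ S.rightSphere l)
      (O : Set (SlideSetting.Model n k)) (_ : IsOpen O) (_ : {z | z.1 = 2 ∧ z.2.1 = 0} ⊆ O)
      (_ : ∀ z ∈ O, Φ.symm z = S.psiR z)
      (_ : ∀ v : EuclideanSpace ℝ (Fin n), ‖v‖ ≤ 1 / 8 →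
        S.preB v ∈ Φ.target ∧ Φ.symm (S.preB v) = S.discB v)
      (r₀ : ℝ) (_ : 0 < r₀) (_ : {z : SlideSetting.Model n k | ‖z.2.2‖ < r₀} ⊆ Φ.target)
      (δ : ℝ) (α : ℝ → ℝ) (_ : 0 < δ) (_ : ContDiff ℝ ∞ α) (_ : ∀ u, u ≤ δ → α u = 5 / 2)
      (_ : ∀ u, 2 * δ ≤ u → α u = 1) (_ : ∀ u, 1 ≤ α u ∧ α u ≤ 5 / 2)
      (F : AmbientIsotopy (𝓡 n) S.V)
      (_ : ∀ t, ∀ p ∈ S.leftSphere, ∀ l, F.toFun t p ∈ S.rightSphere l →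
        l = S.jR ∧ p = S.discA ρ 0 ∧ 1 / 2 ≤ t ∧ Real.smoothTransition (2 * t - 1) = 2 / 3)
      (_ : ∀ t, 1 / 2 ≤ t → ∀ v ∈ S.Flat, ‖v‖ ≤ 1 / 8 →
        F.toFun t (S.discA ρ v) = Φ.symm
          ((1 + Real.smoothTransition (2 * t - 1) * (α (‖(S.preB v).2.1‖ ^ 2) - 1),
            (S.preB v).2.1, (0 : EuclideanSpace ℝ (Fin (n - k)))) : SlideSetting.Model n k))
      (ξ₃ : Cₛ^∞⟮𝓡∂ (n + 1); EuclideanSpace ℝ (Fin (n + 1)), (TangentSpace (𝓡∂ (n + 1)) : c.W → Type)⟯)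
      (_ : IsGradientLike (𝓡∂ (n + 1)) S.g₁ ξ₃)
      (_ : ∀ z, S.g₁ z ∉ Ioo S.c₀ S.c₁ → ξ₃ z = ξ z)
      (ν : ℝ → ℝ)
      (t₁' t₂' : ℝ) (_ : S.c₀ < t₁') (_ : t₁' < t₂') (_ : t₂' < S.c₁)
      (_ : ∀ t, ν t = Real.smoothTransition ((t₂' - t) / (t₂' - t₁')))
      (_ : ∀ q : S.V, ∀ τ ∈ Icc 0 (S.c₁ - S.c₀), ∃ y : c.W, S.g₁ y = S.c₀ + τ ∧
        FlowsTo (𝓡∂ (n + 1)) ξ (S.ι (F.toFun (ν (S.c₀ + τ)) q)) y ∧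
        FlowsTo (𝓡∂ (n + 1)) ξ₃ (S.ι (F.toFun 1 q)) y)
      (_ : leftHandSphere (𝓡∂ (n + 1)) S.g₁ ξ₃ (σ i) S.c₀ = S.ι '' (F.toFun 1 '' S.leftSphere))
      (g' : c.W → ℝ) (_ : ∀ z, S.g₁ z ∈ Ioo S.u S.v → g' z ∈ Ioo S.u S.v),
    ∃ (Vk : Set (EuclideanSpace ℝ (Fin k))) (pstar : EuclideanSpace ℝ (Fin k)) (E : EuclideanSpace ℝ (Fin k) → c.W)
      (hE : ∀ p ∈ Vk, E p ∈ leftHandDisc (𝓡∂ (n + 1)) g' ξ₃ (σ i) t₀),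
      IsOpen Vk ∧ pstar ∈ Vk ∧ ContMDiffOn 𝓘(ℝ, EuclideanSpace ℝ (Fin k)) (𝓡∂ (n + 1)) ∞ E Vk ∧
      Topology.IsEmbedding (fun p : ↥Vk =>
        (⟨E p, hE p p.2⟩ : ↥(leftHandDisc (𝓡∂ (n + 1)) g' ξ₃ (σ i) t₀))) ∧
      IsOpen (range fun p : ↥Vk =>
        (⟨E p, hE p p.2⟩ : ↥(leftHandDisc (𝓡∂ (n + 1)) g' ξ₃ (σ i) t₀))) ∧
      E pstar ∈ unstableSet (𝓡∂ (n + 1)) ξ (σ j) ∧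
      (∀ y ∈ leftHandDisc (𝓡∂ (n + 1)) g' ξ₃ (σ i) t₀, y ∈ unstableSet (𝓡∂ (n + 1)) ξ (σ j) → y = E pstar) ∧
      (∃ alo ahi : ℝ, alo < (S.Lk.symm pstar).1 ∧ t₂' < ahi ∧
        ∀ p, p ∈ Vk ↔ ((S.Lk.symm p).1 ∈ Ioo alo ahi ∧ S.xL + ρ (S.Lk.symm p).2 ∈ S.χL.target)) ∧
      (∀ p ∈ Vk, S.g₁ (E p) = (S.Lk.symm p).1 ∧ (S.Lk.symm p).1 ∈ Ioo S.c₀ S.c₁ ∧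
        FlowsTo (𝓡∂ (n + 1)) ξ (S.ι (F.toFun (ν (S.Lk.symm p).1)
          (S.psiL ρ (((0 : ℝ), (S.Lk.symm p).2, (0 : EuclideanSpace ℝ (Fin (n - k)))) : SlideSetting.Model n k))))
          (E p)) ∧
      (S.Lk.symm pstar).2 = 0 ∧ (S.Lk.symm pstar).1 < t₂' ∧ 1 / 2 ≤ ν (S.Lk.symm pstar).1 ∧
      Real.smoothTransition (2 * ν (S.Lk.symm pstar).1 - 1) = 2 / 3 ∧
      (∀ p ∈ Vk, E p ∈ X) ∧
      ∃ (fK : EuclideanSpace ℝ (Fin k) → EuclideanSpace ℝ (Fin k))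
        (L : EuclideanSpace ℝ (Fin k) →L[ℝ] EuclideanSpace ℝ (Fin k)),
        (∀ᶠ w in 𝓝 pstar, ∀ (hwX : E w ∈ X) (hN : (⟨E w, hwX⟩ : ↥X) ∈ Tj.N), fK w = Tj.K ⟨⟨E w, hwX⟩, hN⟩) ∧
        HasFDerivAt fK L pstar ∧
        LinearMap.det (L : EuclideanSpace ℝ (Fin k) →ₗ[ℝ] EuclideanSpace ℝ (Fin k)) ≠ 0 ∧
        (SignType.sign (LinearMap.det (L : EuclideanSpace ℝ (Fin k) →ₗ[ℝ] EuclideanSpace ℝ (Fin k))) : ℤ) = s₀ := by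
  ----------------------------------------------------------------------------------------------
  -- Step 0: bookkeeping (before the outcome)
  ----------------------------------------------------------------------------------------------
  have hreg := S.band_regular
  have hIcc0 : S.c₀ ∈ Icc S.c₀ S.c₁ := left_mem_Icc.2 S.hc₀c₁.le
  have hband_uv : ∀ y : c.W, S.c₀ ≤ S.g₁ y → S.g₁ y < S.c₁ → S.g₁ y ∈ Ioo S.u S.v := fun y hy0 hy1 =>
    ⟨S.huc₀.trans_le hy0, hy1.trans (S.hc₁bP.trans S.hbPv)⟩
  have hband_X : ∀ y : c.W, S.c₀ ≤ S.g₁ y → S.g₁ y < S.c₁ → y ∈ X := fun y hy0 hy1 =>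
    (hX y).2 (Ioo_subset_Icc_self (S.Ioo_uv_subset (S.apply_mem_Ioo_of_apply₁_mem_Ioo (hband_uv y hy0 hy1))))
  -- the model point of the crossing on the level, `z⋆ = (2, 0, 0)`, and `ψ_R z⋆ ∈ S_R(σ j)`
  set zstar : SlideSetting.Model n k :=
    ((2 : ℝ), (0 : EuclideanSpace ℝ (Fin (k - 1))), (0 : EuclideanSpace ℝ (Fin (n - k)))) with hzstar
  have hzstar_src : zstar ∈ S.psiR.source := S.mem_psiR_source_of_snd_snd_eq_zero rfl
  -- points `ι(ψ_R(2, 0, y))` lie on `S_R(σ j)`, hence on `W^u_ξ(σ j)`, on the level `c₀`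
  have hsphere : ∀ y : EuclideanSpace ℝ (Fin (n - k)),
      S.ι (S.psiR (((2 : ℝ), (0 : EuclideanSpace ℝ (Fin (k - 1))), y) : SlideSetting.Model n k)) ∈
        unstableSet (𝓡∂ (n + 1)) ξ (σ j) := by
    intro y
    have h1 : S.psiR (((2 : ℝ), (0 : EuclideanSpace ℝ (Fin (k - 1))), y) : SlideSetting.Model n k) ∈
        S.rightSphere S.jR := (S.psiR_mem_rightSphere_iff _).2 ⟨rfl, rfl⟩
    have h2 : S.ι (S.psiR (((2 : ℝ), (0 : EuclideanSpace ℝ (Fin (k - 1))), y) : SlideSetting.Model n k)) ∈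
        rightHandSphere (𝓡∂ (n + 1)) S.g₁ ξ (σ j) S.c₀ := by
      rw [show σ j = σ (S.jR : Fin a) from rfl, ← S.image_rightSphere S.jR]
      exact ⟨_, h1, rfl⟩
    exact rightHandSphere_subset_unstableSet h2
  have hy₀R : ∀ y : EuclideanSpace ℝ (Fin (n - k)),
      S.ι (S.psiR (((2 : ℝ), (0 : EuclideanSpace ℝ (Fin (k - 1))), y) : SlideSetting.Model n k)) ∈ R :=
    fun y => hRmem _ (hsphere y) (by rw [S.apply_ι]) (by rw [S.apply_ι]; exact S.hc₀c₁)
  -- `K̃ = 0` at these points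
  have hKt0 : ∀ y : EuclideanSpace ℝ (Fin (n - k)),
      Kt (S.ι (S.psiR (((2 : ℝ), (0 : EuclideanSpace ℝ (Fin (k - 1))), y) : SlideSetting.Model n k))) = 0 := by
    intro y
    have hXmem : S.ι (S.psiR (((2 : ℝ), (0 : EuclideanSpace ℝ (Fin (k - 1))), y) : SlideSetting.Model n k)) ∈ X :=
      hband_X _ (by rw [S.apply_ι]) (by rw [S.apply_ι]; exact S.hc₀c₁)
    obtain ⟨hN, hK⟩ := hKtK ⟨_, hXmem⟩ (hy₀R y)
    rw [← hK]
    exact (Tj.eq_zero_iff _).2 ((hPj _).2 (hsphere y))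
  ----------------------------------------------------------------------------------------------
  -- Step 1: the map `G = K̃ ∘ ι ∘ ψ_R` near `z⋆`, its derivative, and its vanishing directions
  ----------------------------------------------------------------------------------------------
  have hGsmooth : ContMDiffAt 𝓘(ℝ, SlideSetting.Model n k) 𝓘(ℝ, EuclideanSpace ℝ (Fin k)) ∞
      (fun z : SlideSetting.Model n k => Kt (S.ι (S.psiR z))) zstar := by
    have h1 : ContMDiffAt 𝓘(ℝ, SlideSetting.Model n k) (𝓡 n) ∞ S.psiR zstar :=
      S.contMDiffOn_psiR.contMDiffAt (S.psiR.open_source.mem_nhds hzstar_src)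
    have h2 : ContMDiffAt (𝓡 n) (𝓡∂ (n + 1)) ∞ S.ι (S.psiR zstar) := S.hι.contMDiff _
    have h3 : ContMDiffAt (𝓡∂ (n + 1)) 𝓘(ℝ, EuclideanSpace ℝ (Fin k)) ∞ Kt (S.ι (S.psiR zstar)) :=
      hKts.contMDiffAt (hRo.mem_nhds (hy₀R 0))
    exact h3.comp zstar (h2.comp zstar h1)
  have hGd : HasFDerivAt (fun z : SlideSetting.Model n k => Kt (S.ι (S.psiR z)))
      (fderiv ℝ (fun z : SlideSetting.Model n k => Kt (S.ι (S.psiR z))) zstar) zstar :=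
    ((contMDiffAt_iff_contDiffAt.1 hGsmooth).differentiableAt (by simp)).hasFDerivAt
  set G' := fderiv ℝ (fun z : SlideSetting.Model n k => Kt (S.ι (S.psiR z))) zstar with hG'
  -- `G` vanishes on `{(2, 0, y)}`, so `G'` kills the `y`-directions
  have hY : ∀ y : EuclideanSpace ℝ (Fin (n - k)), G' ((0 : ℝ), (0 : EuclideanSpace ℝ (Fin (k - 1))), y) = 0 := by
    have haff : HasFDerivAt (fun y : EuclideanSpace ℝ (Fin (n - k)) =>
        (((2 : ℝ), (0 : EuclideanSpace ℝ (Fin (k - 1))), y) : SlideSetting.Model n k))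
        ((0 : EuclideanSpace ℝ (Fin (n - k)) →L[ℝ] ℝ).prod
          ((0 : EuclideanSpace ℝ (Fin (n - k)) →L[ℝ] EuclideanSpace ℝ (Fin (k - 1))).prod
            (ContinuousLinearMap.id ℝ (EuclideanSpace ℝ (Fin (n - k)))))) 0 :=
      (hasFDerivAt_const _ _).prodMk ((hasFDerivAt_const _ _).prodMk (hasFDerivAt_id _))
    have hcomp := hGd.comp (0 : EuclideanSpace ℝ (Fin (n - k))) haff
    have hzero : HasFDerivAt ((fun z : SlideSetting.Model n k => Kt (S.ι (S.psiR z))) ∘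
        fun y : EuclideanSpace ℝ (Fin (n - k)) =>
          (((2 : ℝ), (0 : EuclideanSpace ℝ (Fin (k - 1))), y) : SlideSetting.Model n k))
        (0 : EuclideanSpace ℝ (Fin (n - k)) →L[ℝ] EuclideanSpace ℝ (Fin k)) 0 :=
      (hasFDerivAt_const (0 : EuclideanSpace ℝ (Fin k)) (0 : EuclideanSpace ℝ (Fin (n - k)))).congr_of_eventuallyEq
        (Eventually.of_forall fun y => hKt0 y)
    have heq := hcomp.unique hzero
    intro y
    have := congrArg (fun φ : EuclideanSpace ℝ (Fin (n - k)) →L[ℝ] EuclideanSpace ℝ (Fin k) => φ y) heq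
    simpa using this
  ----------------------------------------------------------------------------------------------
  -- Step 2: `G'` is onto — a right inverse from the right-inverse germ of `K̃` at a point `y₀`
  -- of `D_R(σ j)` in the band, projected to the level along the flow and read in `ψ_R`
  ----------------------------------------------------------------------------------------------
  obtain ⟨θ, hθ⟩ := S.hg₁.exists_slabFlow ξ.contMDiff S.hξ₁ S.hc₀_pos S.hc₀c₁ S.hc₁_lt_one
  have hθ' := hθ.toPreSlabFlow
  set amid : ℝ := (S.c₀ + S.c₁) / 2 with hamid
  have hamidI : amid ∈ Ioo S.c₀ S.c₁ := ⟨by rw [hamid]; linarith [S.hc₀c₁], by rw [hamid]; linarith [S.hc₀c₁]⟩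
  haveI : Nonempty S.V := ⟨S.psiR zstar⟩
  set y₀ : c.W := Flow.prodMap θ S.g₁ S.ι (S.psiR zstar, amid) with hy₀
  have hy₀flow : FlowsTo (𝓡∂ (n + 1)) ξ (S.ι (S.psiR zstar)) y₀ :=
    hθ'.flowsTo_prodMap hreg hIcc0 S.apply_ι _ (Ioo_subset_Icc_self hamidI) hamidI.1.le
  have hgy₀ : S.g₁ y₀ = amid := hθ'.apply_prodMap hreg hIcc0 S.apply_ι _ (Ioo_subset_Icc_self hamidI)
  have hy₀Ioo : S.g₁ y₀ ∈ Ioo S.c₀ S.c₁ := by rw [hgy₀]; exact hamidI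
  have hy₀u : y₀ ∈ unstableSet (𝓡∂ (n + 1)) ξ (σ j) := hy₀flow.mem_unstableSet_right (hsphere 0)
  have hy₀R' : y₀ ∈ R := hRmem _ hy₀u hy₀Ioo.1.le hy₀Ioo.2
  obtain ⟨m, hm0, hm⟩ := hKtrank y₀ hy₀u hy₀R'
  -- the level point of `y₀` is `ι(ψ_R z⋆)`
  have hlev0 : Flow.levelProj θ S.g₁ S.c₀ y₀ = S.ι (S.psiR zstar) :=
    (hθ'.eq_levelProj_of_flowsTo hreg hIcc0 (S.apply_ι _) (Ioo_subset_Icc_self hy₀Ioo) hy₀flow).symm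
  have hinv0 : (Flow.prodInv θ S.g₁ S.ι S.c₀ y₀).1 = S.psiR zstar := by
    rw [Flow.prodInv_apply]
    show invFun S.ι (Flow.levelProj θ S.g₁ S.c₀ y₀) = S.psiR zstar
    rw [hlev0]
    exact leftInverse_invFun S.injective_ι _
  have hψRz_tgt : S.psiR zstar ∈ S.psiR.target := S.psiR.map_source hzstar_src
  have hmAt : ContMDiffAt 𝓘(ℝ, EuclideanSpace ℝ (Fin k)) (𝓡∂ (n + 1)) ∞ m 0 := hm.self_of_nhds.1
  have hPinv : ContMDiffAt (𝓡∂ (n + 1)) ((𝓡 n).prod 𝓘(ℝ, ℝ)) ∞ (Flow.prodInv θ S.g₁ S.ι S.c₀) (m 0) := by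
    rw [hm0]; exact hθ.contMDiffAt_prodInv hreg S.hι hIcc0 S.range_ι hy₀Ioo
  have hfstAt : ContMDiffAt 𝓘(ℝ, EuclideanSpace ℝ (Fin k)) (𝓡 n) ∞
      (fun w => (Flow.prodInv θ S.g₁ S.ι S.c₀ (m w)).1) 0 :=
    contMDiffAt_fst.comp 0 (hPinv.comp 0 hmAt)
  have hΨAt : ContMDiffAt (𝓡 n) 𝓘(ℝ, SlideSetting.Model n k) ∞ S.psiR.symm
      ((fun w => (Flow.prodInv θ S.g₁ S.ι S.c₀ (m w)).1) 0) := by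
    show ContMDiffAt (𝓡 n) 𝓘(ℝ, SlideSetting.Model n k) ∞ S.psiR.symm (Flow.prodInv θ S.g₁ S.ι S.c₀ (m 0)).1
    rw [hm0, hinv0]
    exact S.contMDiffOn_psiR_symm.contMDiffAt (S.psiR.open_target.mem_nhds hψRz_tgt)
  have hmtAt : ContMDiffAt 𝓘(ℝ, EuclideanSpace ℝ (Fin k)) 𝓘(ℝ, SlideSetting.Model n k) ∞
      (fun w => S.psiR.symm (Flow.prodInv θ S.g₁ S.ι S.c₀ (m w)).1) 0 := hΨAt.comp 0 hfstAt
  have hmt0 : (fun w => S.psiR.symm (Flow.prodInv θ S.g₁ S.ι S.c₀ (m w)).1) 0 = zstar := by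
    show S.psiR.symm (Flow.prodInv θ S.g₁ S.ι S.c₀ (m 0)).1 = zstar
    rw [hm0, hinv0]
    exact S.psiR.left_inv hzstar_src
  have hmtd : HasFDerivAt (fun w => S.psiR.symm (Flow.prodInv θ S.g₁ S.ι S.c₀ (m w)).1)
      (fderiv ℝ (fun w => S.psiR.symm (Flow.prodInv θ S.g₁ S.ι S.c₀ (m w)).1) 0) 0 :=
    ((contMDiffAt_iff_contDiffAt.1 hmtAt).differentiableAt (by simp)).hasFDerivAt
  -- `G ∘ m̃ = id` near `0`
  have hGmt : ((fun z : SlideSetting.Model n k => Kt (S.ι (S.psiR z))) ∘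
      fun w => S.psiR.symm (Flow.prodInv θ S.g₁ S.ι S.c₀ (m w)).1) =ᶠ[𝓝 0] id := by
    have hmc : ContinuousAt m 0 := hmAt.continuousAt
    have hev1 : ∀ᶠ w in 𝓝 (0 : EuclideanSpace ℝ (Fin k)), S.g₁ (m w) ∈ Ioo S.c₀ S.c₁ := by
      have hc : ContinuousAt (fun w => S.g₁ (m w)) 0 := (S.contMDiff_g₁.continuous.continuousAt).comp hmc
      refine hc.preimage_mem_nhds (isOpen_Ioo.mem_nhds ?_)
      show S.g₁ (m 0) ∈ Ioo S.c₀ S.c₁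
      rw [hm0]; exact hy₀Ioo
    have hev2 : ∀ᶠ w in 𝓝 (0 : EuclideanSpace ℝ (Fin k)), (Flow.prodInv θ S.g₁ S.ι S.c₀ (m w)).1 ∈ S.psiR.target := by
      refine hfstAt.continuousAt.preimage_mem_nhds (S.psiR.open_target.mem_nhds ?_)
      show (Flow.prodInv θ S.g₁ S.ι S.c₀ (m 0)).1 ∈ S.psiR.target
      rw [hm0, hinv0]; exact hψRz_tgt
    have hev3 : ∀ᶠ w in 𝓝 (0 : EuclideanSpace ℝ (Fin k)), S.ι (Flow.prodInv θ S.g₁ S.ι S.c₀ (m w)).1 ∈ R := by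
      have hc : ContinuousAt (fun w => S.ι (Flow.prodInv θ S.g₁ S.ι S.c₀ (m w)).1) 0 :=
        S.continuous_ι.continuousAt.comp hfstAt.continuousAt
      refine hc.preimage_mem_nhds (hRo.mem_nhds ?_)
      show S.ι (Flow.prodInv θ S.g₁ S.ι S.c₀ (m 0)).1 ∈ R
      rw [hm0, hinv0]; exact hy₀R 0
    filter_upwards [hm, hev1, hev2, hev3] with w hw h1 h2 h3
    obtain ⟨-, hwR, hKw⟩ := hw
    show Kt (S.ι (S.psiR (S.psiR.symm (Flow.prodInv θ S.g₁ S.ι S.c₀ (m w)).1))) = w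
    rw [S.psiR.right_inv h2]
    have hιeq : S.ι (Flow.prodInv θ S.g₁ S.ι S.c₀ (m w)).1 = Flow.levelProj θ S.g₁ S.c₀ (m w) := by
      rw [Flow.prodInv_apply]
      exact hθ'.apply_invFun_levelProj hreg hIcc0 S.range_ι (Ioo_subset_Icc_self h1)
    have hfl : FlowsTo (𝓡∂ (n + 1)) (⇑ξ) (S.ι (Flow.prodInv θ S.g₁ S.ι S.c₀ (m w)).1) (m w) := by
      rw [hιeq]
      exact hθ'.flowsTo_levelProj hreg (Ioo_subset_Icc_self h1) hIcc0 h1.1.le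
    rw [hKtinv _ _ h3 hwR hfl, hKw]
  have hGm : G'.comp (fderiv ℝ (fun w => S.psiR.symm (Flow.prodInv θ S.g₁ S.ι S.c₀ (m w)).1) 0) =
      ContinuousLinearMap.id ℝ (EuclideanSpace ℝ (Fin k)) := by
    have hGd' : HasFDerivAt (fun z : SlideSetting.Model n k => Kt (S.ι (S.psiR z))) G'
        ((fun w => S.psiR.symm (Flow.prodInv θ S.g₁ S.ι S.c₀ (m w)).1) 0) := by rw [hmt0]; exact hGd
    exact (hGd'.comp 0 hmtd).unique ((hasFDerivAt_id (0 : EuclideanSpace ℝ (Fin k))).congr_of_eventuallyEq hGmt)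
  have hGmw : ∀ w, G' (fderiv ℝ (fun w => S.psiR.symm (Flow.prodInv θ S.g₁ S.ι S.c₀ (m w)).1) 0 w) = w := fun w => by
    have := congrArg (fun φ : EuclideanSpace ℝ (Fin k) →L[ℝ] EuclideanSpace ℝ (Fin k) => φ w) hGm
    simpa using this
  ----------------------------------------------------------------------------------------------
  -- Step 3: the sheet coordinate, the fixed map `A = G' ∘ (1 ⊕ X') ∘ L_k⁻¹` and the sign `s₀`
  ----------------------------------------------------------------------------------------------
  obtain ⟨X', hX'inj, hXd⟩ := S.exists_hasFDerivAt_sheetCoord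
  set φ₁ : EuclideanSpace ℝ (Fin k) →L[ℝ] ℝ :=
    (ContinuousLinearMap.fst ℝ ℝ (EuclideanSpace ℝ (Fin (k - 1)))).comp
      (S.Lk.symm : EuclideanSpace ℝ (Fin k) →L[ℝ] ℝ × EuclideanSpace ℝ (Fin (k - 1))) with hφ₁
  set φ₂ : EuclideanSpace ℝ (Fin k) →L[ℝ] EuclideanSpace ℝ (Fin (k - 1)) :=
    (ContinuousLinearMap.snd ℝ ℝ (EuclideanSpace ℝ (Fin (k - 1)))).comp
      (S.Lk.symm : EuclideanSpace ℝ (Fin k) →L[ℝ] ℝ × EuclideanSpace ℝ (Fin (k - 1))) with hφ₂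
  set Alin : EuclideanSpace ℝ (Fin k) →L[ℝ] EuclideanSpace ℝ (Fin k) :=
    G'.comp ((((1 : ℝ) • φ₁)).prod ((X'.comp φ₂).prod (0 : EuclideanSpace ℝ (Fin k) →L[ℝ] EuclideanSpace ℝ (Fin (n - k)))))
    with hAlin
  have hAdet : LinearMap.det (Alin : EuclideanSpace ℝ (Fin k) →ₗ[ℝ] EuclideanSpace ℝ (Fin k)) ≠ 0 :=
    crossing_det_ne_zero S.hk1 G' _ hGmw hY one_ne_zero X' hX'inj S.Lk.symm
  set s₀ : ℤ := -(SignType.sign (LinearMap.det (Alin : EuclideanSpace ℝ (Fin k) →ₗ[ℝ] EuclideanSpace ℝ (Fin k))) : ℤ)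
    with hs₀
  have hs₀1 : s₀ = 1 ∨ s₀ = -1 := by
    rcases hAdet.lt_or_gt with h | h
    · left; rw [hs₀, sign_neg h]; simp
    · right; rw [hs₀, sign_pos h]; simp
  refine ⟨s₀, hs₀1, ?_⟩
  ----------------------------------------------------------------------------------------------
  -- Step 4: the outcome; the crossing chart (reaching the level `t₂'`)
  ----------------------------------------------------------------------------------------------
  intro ρ f hfW hfFlat Φ hΦsm hΦsm' hsph hother O hOo hOsub hO hcentre r₀ hr₀ hr₀sub δ α hδ hαs hαδ hα2δ
    hαb F hcross hformula ξ₃ hξ₃ hξ₃eq ν t₁' t₂' h01' h12 h2c hνt htrack hleft g' hIoo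
  have hνfun : ν = fun t => Real.smoothTransition ((t₂' - t) / (t₂' - t₁')) := funext hνt
  have hνs : ContDiff ℝ ∞ ν := by
    rw [hνfun]
    exact Real.smoothTransition.contDiff.comp ((contDiff_const.sub contDiff_id).div_const _)
  have hνc : Continuous ν := hνs.continuous
  obtain ⟨Vk, pstar, E, hE, hVko, hpstar, hEs, hemb, hopen, hstar, huniq, ⟨alo, ahi, halo, hahi, hVk⟩,
      hEp, hx0, ha2, hνhalf, hlam⟩ :=
    S.exists_crossingChart ρ hsph hδ hαδ hξ₃ hξ₃eq hcross hformula hνs h01' h12 h2c hνt htrack hleft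
      hIoo le_rfl h2c
  set astar : ℝ := (S.Lk.symm pstar).1 with hastar
  obtain ⟨hgstar, hastarI, hflowstar⟩ := hEp pstar hpstar
  rw [hx0] at hflowstar
  have hystarIoo : S.g₁ (E pstar) ∈ Ioo S.c₀ S.c₁ := by rw [hgstar]; exact hastarI
  have hzstar_O : zstar ∈ O := hOsub ⟨rfl, rfl⟩
  have hzstar_tgt : zstar ∈ Φ.target := hr₀sub (by show ‖(0 : EuclideanSpace ℝ (Fin (n - k)))‖ < r₀; rw [norm_zero]; exact hr₀)
  have hΦzstar : Φ.symm zstar = S.psiR zstar := hO zstar hzstar_O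
  have hFstar : F.toFun (ν astar) (S.discA ρ 0) = Φ.symm zstar := by
    rw [hformula (ν astar) hνhalf 0 S.Flat.zero_mem (by rw [norm_zero]; norm_num), S.preB_zero]
    congr 1
    refine Prod.ext ?_ (Prod.ext rfl rfl)
    show 1 + Real.smoothTransition (2 * ν astar - 1) *
      (α (‖(0 : EuclideanSpace ℝ (Fin (k - 1)))‖ ^ 2) - 1) = 2
    rw [norm_zero, zero_pow two_ne_zero, hαδ 0 hδ.le, hlam]
    norm_num
  -- the points of the chart lie in `X`
  have hEX : ∀ p ∈ Vk, E p ∈ X := by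
    intro p hp
    obtain ⟨hgp, hpI, -⟩ := hEp p hp
    exact hband_X _ (by rw [hgp]; exact hpI.1.le) (by rw [hgp]; exact hpI.2)
  -- the region `R` contains `E p⋆`
  have hystarR : E pstar ∈ R := hRmem _ hstar hystarIoo.1.le hystarIoo.2
  ----------------------------------------------------------------------------------------------
  -- Step 5: `K̃ ∘ E = G ∘ Ψ` near `p⋆`, with `Ψ(L_k(a, x)) = (1 + (3/2) λ(2ν(a) - 1), X(x), 0)`
  ----------------------------------------------------------------------------------------------
  obtain ⟨d, hd, hσd⟩ := hasDerivAt_sweepProfile (astar := astar) h12 (by rw [← hνt]; exact hlam)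
  have hφ₁d : HasFDerivAt (fun p : EuclideanSpace ℝ (Fin k) => (S.Lk.symm p).1) φ₁ pstar := φ₁.hasFDerivAt
  have hφ₂d : HasFDerivAt (fun p : EuclideanSpace ℝ (Fin k) => (S.Lk.symm p).2) φ₂ pstar := φ₂.hasFDerivAt
  set Ψ : EuclideanSpace ℝ (Fin k) → SlideSetting.Model n k := fun p =>
    ((1 + Real.smoothTransition (2 * Real.smoothTransition ((t₂' - (S.Lk.symm p).1) / (t₂' - t₁')) - 1) *
        (5 / 2 - 1),
      (S.preB ((univBall (0 : EuclideanSpace ℝ (Fin n)) S.rA).symm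
        (S.L₃.symm (((0 : ℝ), (S.Lk.symm p).2, (0 : EuclideanSpace ℝ (Fin (n - k)))) : SlideSetting.Model n k)))).2.1,
      (0 : EuclideanSpace ℝ (Fin (n - k)))) : SlideSetting.Model n k) with hΨ
  have hXd' : HasFDerivAt (fun x : EuclideanSpace ℝ (Fin (k - 1)) =>
      (S.preB ((univBall (0 : EuclideanSpace ℝ (Fin n)) S.rA).symm
        (S.L₃.symm (((0 : ℝ), x, (0 : EuclideanSpace ℝ (Fin (n - k)))) : SlideSetting.Model n k)))).2.1) X'
      ((fun p : EuclideanSpace ℝ (Fin k) => (S.Lk.symm p).2) pstar) := by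
    show HasFDerivAt _ X' (S.Lk.symm pstar).2
    rw [hx0]; exact hXd
  have hσd' : HasDerivAt (fun a' : ℝ => 1 + Real.smoothTransition
      (2 * Real.smoothTransition ((t₂' - a') / (t₂' - t₁')) - 1) * (5 / 2 - 1)) d
      ((fun p : EuclideanSpace ℝ (Fin k) => (S.Lk.symm p).1) pstar) := hσd
  have hΨd : HasFDerivAt Ψ ((d • φ₁).prod ((X'.comp φ₂).prod (0 : EuclideanSpace ℝ (Fin k) →L[ℝ] EuclideanSpace ℝ (Fin (n - k))))) pstar := by
    show HasFDerivAt (fun p : EuclideanSpace ℝ (Fin k) =>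
      ((1 + Real.smoothTransition (2 * Real.smoothTransition ((t₂' - (S.Lk.symm p).1) / (t₂' - t₁')) - 1) *
          (5 / 2 - 1),
        (S.preB ((univBall (0 : EuclideanSpace ℝ (Fin n)) S.rA).symm
          (S.L₃.symm (((0 : ℝ), (S.Lk.symm p).2, (0 : EuclideanSpace ℝ (Fin (n - k)))) : SlideSetting.Model n k)))).2.1,
        (0 : EuclideanSpace ℝ (Fin (n - k)))) : SlideSetting.Model n k)) _ pstar
    exact (hσd'.comp_hasFDerivAt pstar hφ₁d).prodMk ((hXd'.comp pstar hφ₂d).prodMk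
      (hasFDerivAt_const (0 : EuclideanSpace ℝ (Fin (n - k))) pstar))
  have hA0 : (univBall (0 : EuclideanSpace ℝ (Fin n)) S.rA).symm 0 = 0 := by
    have h := (univBall (0 : EuclideanSpace ℝ (Fin n)) S.rA).left_inv (x := 0) (by rw [univBall_source]; trivial)
    rwa [univBall_apply_zero] at h
  have hΨstar : Ψ pstar = zstar := by
    show ((1 + Real.smoothTransition (2 * Real.smoothTransition ((t₂' - (S.Lk.symm pstar).1) / (t₂' - t₁')) - 1) *
        (5 / 2 - 1),
      (S.preB ((univBall (0 : EuclideanSpace ℝ (Fin n)) S.rA).symm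
        (S.L₃.symm (((0 : ℝ), (S.Lk.symm pstar).2, (0 : EuclideanSpace ℝ (Fin (n - k)))) : SlideSetting.Model n k)))).2.1,
      (0 : EuclideanSpace ℝ (Fin (n - k)))) : SlideSetting.Model n k) = zstar
    rw [hx0, ← hνt, hlam]
    rw [show S.L₃.symm (((0 : ℝ), (0 : EuclideanSpace ℝ (Fin (k - 1))), (0 : EuclideanSpace ℝ (Fin (n - k)))) :
      SlideSetting.Model n k) = 0 from map_zero _, hA0, S.preB_zero]
    refine Prod.ext ?_ (Prod.ext rfl rfl)
    show (1 : ℝ) + 2 / 3 * (5 / 2 - 1) = 2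
    norm_num
  have hGdΨ : HasFDerivAt (fun z : SlideSetting.Model n k => Kt (S.ι (S.psiR z))) G' (Ψ pstar) := by
    rw [hΨstar]; exact hGd
  have hL : HasFDerivAt ((fun z : SlideSetting.Model n k => Kt (S.ι (S.psiR z))) ∘ Ψ)
      (G'.comp ((d • φ₁).prod ((X'.comp φ₂).prod (0 : EuclideanSpace ℝ (Fin k) →L[ℝ] EuclideanSpace ℝ (Fin (n - k)))))) pstar :=
    hGdΨ.comp pstar hΨd
  -- `K̃ ∘ E = G ∘ Ψ` near `p⋆`
  have hEc : ContinuousAt E pstar := (hEs.continuousOn.continuousWithinAt hpstar).continuousAt (hVko.mem_nhds hpstar)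
  have hΨc : ContinuousAt Ψ pstar := hΨd.continuousAt
  have hfeq : (fun p => Kt (E p)) =ᶠ[𝓝 pstar] ((fun z : SlideSetting.Model n k => Kt (S.ι (S.psiR z))) ∘ Ψ) := by
    -- (E1) `p ∈ Vk`
    have hE1 : ∀ᶠ p in 𝓝 pstar, p ∈ Vk := hVko.mem_nhds hpstar
    -- (E2) `E p ∈ R`
    have hE2 : ∀ᶠ p in 𝓝 pstar, E p ∈ R := hEc.preimage_mem_nhds (hRo.mem_nhds hystarR)
    -- (E3) the sheet point lies in the ball of the squeeze
    have hshc : Continuous fun p : EuclideanSpace ℝ (Fin k) =>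
        S.L₃.symm (((0 : ℝ), (S.Lk.symm p).2, (0 : EuclideanSpace ℝ (Fin (n - k)))) : SlideSetting.Model n k) :=
      S.L₃.symm.continuous.comp (continuous_const.prodMk ((continuous_snd.comp S.Lk.symm.continuous).prodMk continuous_const))
    have hsh0 : S.L₃.symm (((0 : ℝ), (S.Lk.symm pstar).2, (0 : EuclideanSpace ℝ (Fin (n - k)))) : SlideSetting.Model n k) = 0 := by
      rw [hx0]; exact map_zero _
    have hE3 : ∀ᶠ p in 𝓝 pstar,
        S.L₃.symm (((0 : ℝ), (S.Lk.symm p).2, (0 : EuclideanSpace ℝ (Fin (n - k)))) : SlideSetting.Model n k) ∈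
          ball (0 : EuclideanSpace ℝ (Fin n)) S.rA := by
      refine hshc.continuousAt.preimage_mem_nhds (isOpen_ball.mem_nhds ?_)
      rw [hsh0]; exact mem_ball_self S.rA_pos
    -- (E4) the docked flat vector has norm `≤ 1/8`
    have hvc : ContinuousAt (fun p : EuclideanSpace ℝ (Fin k) => (univBall (0 : EuclideanSpace ℝ (Fin n)) S.rA).symm
        (S.L₃.symm (((0 : ℝ), (S.Lk.symm p).2, (0 : EuclideanSpace ℝ (Fin (n - k)))) : SlideSetting.Model n k))) pstar := by
      refine ContinuousAt.comp ?_ hshc.continuousAt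
      rw [hsh0]
      exact (univBall (0 : EuclideanSpace ℝ (Fin n)) S.rA).continuousAt_symm
        (by rw [univBall_target _ S.rA_pos]; exact mem_ball_self S.rA_pos)
    have hv0 : (univBall (0 : EuclideanSpace ℝ (Fin n)) S.rA).symm
        (S.L₃.symm (((0 : ℝ), (S.Lk.symm pstar).2, (0 : EuclideanSpace ℝ (Fin (n - k)))) : SlideSetting.Model n k)) = 0 := by
      rw [hsh0]; exact hA0
    have hE4 : ∀ᶠ p in 𝓝 pstar, ‖(univBall (0 : EuclideanSpace ℝ (Fin n)) S.rA).symm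
        (S.L₃.symm (((0 : ℝ), (S.Lk.symm p).2, (0 : EuclideanSpace ℝ (Fin (n - k)))) : SlideSetting.Model n k))‖ < 1 / 8 := by
      refine hvc.norm.eventually_lt continuousAt_const ?_
      show ‖(univBall (0 : EuclideanSpace ℝ (Fin n)) S.rA).symm
        (S.L₃.symm (((0 : ℝ), (S.Lk.symm pstar).2, (0 : EuclideanSpace ℝ (Fin (n - k)))) : SlideSetting.Model n k))‖ < 1 / 8
      rw [hv0, norm_zero]; norm_num
    -- (E5) the sweep time is `≥ 1/2`
    have hνstar : 1 / 2 < ν astar := by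
      have hI := SlideSetting.mem_Ioo_of_smoothTransition_mem_Ioo (x := 2 * ν astar - 1)
        (by rw [hlam]; norm_num) (by rw [hlam]; norm_num)
      linarith [hI.1]
    have hE5 : ∀ᶠ p in 𝓝 pstar, 1 / 2 < ν (S.Lk.symm p).1 := by
      have hc : ContinuousAt (fun p : EuclideanSpace ℝ (Fin k) => ν (S.Lk.symm p).1) pstar :=
        (hνc.comp (continuous_fst.comp S.Lk.symm.continuous)).continuousAt
      exact continuousAt_const.eventually_lt hc hνstar
    -- (E6) the isotoped sheet point, on the level, lies in `R`
    have hqc : ContinuousAt (fun p : EuclideanSpace ℝ (Fin k) =>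
        S.ι (F.toFun (ν (S.Lk.symm p).1) (S.psiL ρ (((0 : ℝ), (S.Lk.symm p).2,
          (0 : EuclideanSpace ℝ (Fin (n - k)))) : SlideSetting.Model n k)))) pstar := by
      have hF : Continuous (uncurry F.toFun) := F.contMDiff.continuous
      have hνp : Continuous fun p : EuclideanSpace ℝ (Fin k) => ν (S.Lk.symm p).1 :=
        hνc.comp (continuous_fst.comp S.Lk.symm.continuous)
      have hsrc : (((0 : ℝ), (S.Lk.symm pstar).2, (0 : EuclideanSpace ℝ (Fin (n - k)))) : SlideSetting.Model n k) ∈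
          (S.psiL ρ).source := by
        rw [S.mem_psiL_source_iff, hx0]
        simpa using S.xL_mem_target
      have hA : ContinuousAt (fun p : EuclideanSpace ℝ (Fin k) => S.psiL ρ (((0 : ℝ), (S.Lk.symm p).2,
          (0 : EuclideanSpace ℝ (Fin (n - k)))) : SlideSetting.Model n k)) pstar := by
        refine ContinuousAt.comp ((S.psiL ρ).continuousAt hsrc) ?_
        exact (continuous_const.prodMk ((continuous_snd.comp S.Lk.symm.continuous).prodMk continuous_const)).continuousAt
      exact S.continuous_ι.continuousAt.comp (hF.continuousAt.comp (hνp.continuousAt.prodMk hA))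
    have hq0 : S.ι (F.toFun (ν (S.Lk.symm pstar).1) (S.psiL ρ (((0 : ℝ), (S.Lk.symm pstar).2,
        (0 : EuclideanSpace ℝ (Fin (n - k)))) : SlideSetting.Model n k))) = S.ι (S.psiR zstar) := by
      rw [hx0, S.psiL_sheet_zero ρ]
      show S.ι (F.toFun (ν astar) (S.discA ρ 0)) = _
      rw [hFstar, hΦzstar]
    have hE6 : ∀ᶠ p in 𝓝 pstar, S.ι (F.toFun (ν (S.Lk.symm p).1) (S.psiL ρ (((0 : ℝ), (S.Lk.symm p).2,
        (0 : EuclideanSpace ℝ (Fin (n - k)))) : SlideSetting.Model n k))) ∈ R := by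
      refine hqc.preimage_mem_nhds (hRo.mem_nhds ?_)
      rw [hq0]; exact hy₀R 0
    -- (E7) the sheet coordinate is small: `α = 5/2` there
    have hE7 : ∀ᶠ p in 𝓝 pstar, ‖(S.preB ((univBall (0 : EuclideanSpace ℝ (Fin n)) S.rA).symm
        (S.L₃.symm (((0 : ℝ), (S.Lk.symm p).2, (0 : EuclideanSpace ℝ (Fin (n - k)))) : SlideSetting.Model n k)))).2.1‖ ^ 2 < δ := by
      have hc : ContinuousAt (fun p : EuclideanSpace ℝ (Fin k) => ‖(S.preB ((univBall (0 : EuclideanSpace ℝ (Fin n)) S.rA).symm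
          (S.L₃.symm (((0 : ℝ), (S.Lk.symm p).2, (0 : EuclideanSpace ℝ (Fin (n - k)))) : SlideSetting.Model n k)))).2.1‖ ^ 2) pstar :=
        ((continuous_fst.comp continuous_snd).continuousAt.comp (S.continuous_preB.continuousAt.comp hvc)).norm.pow 2
      have h0 : ‖(S.preB ((univBall (0 : EuclideanSpace ℝ (Fin n)) S.rA).symm
          (S.L₃.symm (((0 : ℝ), (S.Lk.symm pstar).2, (0 : EuclideanSpace ℝ (Fin (n - k)))) : SlideSetting.Model n k)))).2.1‖ ^ 2 = 0 := by
        rw [hv0, S.preB_zero]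
        simp
      refine hc.eventually_lt continuousAt_const ?_
      show ‖(S.preB ((univBall (0 : EuclideanSpace ℝ (Fin n)) S.rA).symm
          (S.L₃.symm (((0 : ℝ), (S.Lk.symm pstar).2, (0 : EuclideanSpace ℝ (Fin (n - k)))) : SlideSetting.Model n k)))).2.1‖ ^ 2 < δ
      rw [h0]; exact hδ
    -- (E8) `Ψ p ∈ O`, where `Φ⁻¹ = ψ_R`
    have hE8 : ∀ᶠ p in 𝓝 pstar, Ψ p ∈ O := by
      refine hΨc.preimage_mem_nhds (hOo.mem_nhds ?_)
      rw [hΨstar]; exact hzstar_O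
    filter_upwards [hE1, hE2, hE3, hE4, hE5, hE6, hE7, hE8] with p h1 h2 h3 h4 h5 h6 h7 h8
    -- abbreviations
    obtain ⟨hgp, hpI, hflowp⟩ := hEp p h1
    set x : EuclideanSpace ℝ (Fin (k - 1)) := (S.Lk.symm p).2 with hxdef
    set v : EuclideanSpace ℝ (Fin n) := (univBall (0 : EuclideanSpace ℝ (Fin n)) S.rA).symm
      (S.L₃.symm (((0 : ℝ), x, (0 : EuclideanSpace ℝ (Fin (n - k)))) : SlideSetting.Model n k)) with hvdef
    obtain ⟨hAx, hvF⟩ := S.discA_symm_sheet ρ h3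
    -- flow invariance of `K̃`
    have hK1 : Kt (E p) = Kt (S.ι (F.toFun (ν (S.Lk.symm p).1) (S.psiL ρ (((0 : ℝ), x,
        (0 : EuclideanSpace ℝ (Fin (n - k)))) : SlideSetting.Model n k)))) :=
      (hKtinv _ _ h6 h2 hflowp).symm
    -- the formula of the isotopy at the docked flat vector
    have hΨp : Ψ p = ((1 + Real.smoothTransition (2 * ν (S.Lk.symm p).1 - 1) * (5 / 2 - 1),
        (S.preB v).2.1, (0 : EuclideanSpace ℝ (Fin (n - k)))) : SlideSetting.Model n k) := by
      simp only [hΨ, hνt, hvdef, hxdef]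
    show Kt (E p) = Kt (S.ι (S.psiR (Ψ p)))
    rw [← hO _ h8, hK1, hΨp, ← hAx, hformula _ h5.le v hvF h4.le, hαδ _ h7.le]
  have hfd : HasFDerivAt (fun p => Kt (E p))
      (G'.comp ((d • φ₁).prod ((X'.comp φ₂).prod (0 : EuclideanSpace ℝ (Fin k) →L[ℝ] EuclideanSpace ℝ (Fin (n - k)))))) pstar :=
    hL.congr_of_eventuallyEq hfeq
  ----------------------------------------------------------------------------------------------
  -- Step 6: the determinant and its sign
  ----------------------------------------------------------------------------------------------
  have hLdet : LinearMap.det ((G'.comp ((d • φ₁).prod ((X'.comp φ₂).prod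
      (0 : EuclideanSpace ℝ (Fin k) →L[ℝ] EuclideanSpace ℝ (Fin (n - k)))))) :
        EuclideanSpace ℝ (Fin k) →ₗ[ℝ] EuclideanSpace ℝ (Fin k)) ≠ 0 :=
    crossing_det_ne_zero S.hk1 G' _ hGmw hY hd.ne X' hX'inj S.Lk.symm
  have hLsmul : LinearMap.det ((G'.comp ((d • φ₁).prod ((X'.comp φ₂).prod
      (0 : EuclideanSpace ℝ (Fin k) →L[ℝ] EuclideanSpace ℝ (Fin (n - k)))))) :
        EuclideanSpace ℝ (Fin k) →ₗ[ℝ] EuclideanSpace ℝ (Fin k)) =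
      d * LinearMap.det (Alin : EuclideanSpace ℝ (Fin k) →ₗ[ℝ] EuclideanSpace ℝ (Fin k)) :=
    crossing_det_smul S.hk1 G' _ hGmw hY d X' S.Lk.symm
  have hsign : (SignType.sign (LinearMap.det ((G'.comp ((d • φ₁).prod ((X'.comp φ₂).prod
      (0 : EuclideanSpace ℝ (Fin k) →L[ℝ] EuclideanSpace ℝ (Fin (n - k)))))) :
        EuclideanSpace ℝ (Fin k) →ₗ[ℝ] EuclideanSpace ℝ (Fin k))) : ℤ) = s₀ := by
    rw [hLsmul, sign_mul, sign_neg hd, hs₀]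
    simp
  -- the datum's `K` agrees with `K̃ ∘ E` near `p⋆`
  have hf : ∀ᶠ w in 𝓝 pstar, ∀ (hwX : E w ∈ X) (hN : (⟨E w, hwX⟩ : ↥X) ∈ Tj.N),
      (fun p => Kt (E p)) w = Tj.K ⟨⟨E w, hwX⟩, hN⟩ := by
    filter_upwards [hEc.preimage_mem_nhds (hRo.mem_nhds hystarR)] with w hw hwX hN
    obtain ⟨hN', hK⟩ := hKtK ⟨E w, hwX⟩ hw
    exact hK.symm
  exact ⟨Vk, pstar, E, hE, hVko, hpstar, hEs, hemb, hopen, hstar, huniq, ⟨alo, ahi, halo, hahi, hVk⟩, hEp,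
    hx0, ha2, hνhalf, hlam, hEX, fun p => Kt (E p), _, hf, hfd, hLdet, hsign⟩

end Literature.Topology.FourManifolds

end
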